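import Summits.BirchSwinnertonDyer.BirchSwinnertonDyer.Theorems.ManinLocalTwoThreeNegOneTwistIstarZeroExits
import Literature.NumberTheory.DiophantineGeometry.TateAlgorithmIstarSuccNormalFormProofs
import Literature.NumberTheory.DiophantineGeometry.TateAlgorithmOggBound
import HarnessLib

/-!
# The normal form of Kodaira type `I₂*` with its exit witness, and `ord Δ = 10 ⟹ a₁/2 ∈ Rˣ` when `2` is a uniformiser
# (route `ManinLocalTwoThree`, crux C2 `ManinOddAtFour` stmt-BirchSwinnertonDyer-22967; S-an-63 «16 ∥ N descends», row I₂*/10; p3 gen 12)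

The tree's `exists_smul_of_kodairaSymbolOfMinimal_eq_Istar_succ` gives only the ROUND-0 shape of an `Iₙ*` model (`π ∣ a₁`, `π ∥ a₂`,
`π² ∣ a₃`, `π³ ∣ a₄`, `π⁴ ∣ a₆`).  For `n = 2` the sub-procedure exits at the SECOND test of round `0`; unfolding one round
(`istarIndexAux_succ`: first test fails — else `n = 1` —, translation `istarA`, second test fires — else the value is `0` or `≥ 3`,
`istarIndexAux_eq_zero_or_le`) yields the deeper normal form **`π ∣ a₁`, `π ∥ a₂`, `π³ ∣ a₃`, `π³ ∥ a₄`, `π⁵ ∣ a₆`**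
(`exists_smul_of_kodairaSymbolOfMinimal_eq_Istar_two_of_two_mem`; the exit witness `π⁴ ∤ a₄` is read from the separable quadratic
`a₂,₁X² + a₄,₃X + a₆,₅` in residue characteristic `2`, where `b² − 4ac = b²`).  With `2` a uniformiser, on `[2α, 2p, 8γ, 8q, 32r]`
(`p, q` units) `Δ = 2¹⁰(α⁴q² + 2Y)` (`Δ_eq_of_istarTwoForm`), so `ord Δ = 10` — the `f = 4` stratum of `I₂*` — forces `α ∈ Rˣ`
(`isUnit_of_istarTwoForm_of_addVal_eq_ten`).  Consumer: the sibling `…NegOneTwistIstarTwoTen` (twist → III*).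
HONEST FRAMING: Tate-algorithm bookkeeping; nothing about BSD or Manin's conjecture is proved; C2 OPEN.
[cite: SilvermanATAEC1994, IV.9.4 Step 7 (PDF pp. 345–346) and Table 4.1]
-/

set_option autoImplicit false
-- lint-debt: the directory name repeats the summit name (sibling precedent `ManinLocalTwoThreeNegOneTwistConductorAtTwo.lean`)
set_option linter.dupNamespace false

noncomputable section

open scoped Classical
open Polynomial IsLocalRing WeierstrassCurve
open IsDiscreteValuationRing hiding maximalIdeal
open Literature.NumberTheory.DiophantineGeometry Literature.NumberTheory.DiophantineGeometry.TateAlgorithm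
  Literature.NumberTheory.DiophantineGeometry.TateAlgorithm.CharTwo

namespace Summit.BirchSwinnertonDyer.BirchSwinnertonDyer.Theorems.ManinLocalTwoThree

section General

variable {R : Type*} [CommRing R] [IsDomain R] [IsDiscreteValuationRing R]

/-- **The `Iₙ*` sub-procedure from round `m` returns `0` (out of fuel) or at least `2m + 1`.** [cite: SilvermanATAEC1994, IV.9.4 Step 7] -/
theorem istarIndexAux_eq_zero_or_le [PerfectField (ResidueField R)] :
    ∀ (fuel m : ℕ) (W : WeierstrassCurve R), istarIndexAux fuel m W = 0 ∨ 2 * m + 1 ≤ istarIndexAux fuel m W := by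
  intro fuel
  induction fuel with
  | zero => intro m W; left; exact istarIndexAux_zero m W
  | succ k ih =>
    intro m W
    rw [istarIndexAux_succ]
    dsimp only
    split_ifs <;> first
      | exact Or.inr le_rfl
      | exact Or.inr (by omega)
      | exact (ih (m + 1) _).imp id (fun h ↦ by omega)

/-- **The normal form of type `I₂*` with its exit witness.**  Over a perfect residue field, if Tate's algorithm returns `Istar 2` on `V`
then some `R`-model `D • V` with `D.u = 1` has `π ∣ a₁`, `π ∥ a₂`, `π³ ∣ a₃`, `π³ ∣ a₄`, `π⁴ ∤ a₄`, `π⁵ ∣ a₆`: round `0` of Step 7 fails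
its first test, and after the translation of the second half the second test FIRES (`a₄,₃ ≠ 0`; the coefficient `a₂,₁` is a unit and, in
residue characteristic `2`, separability of `a₂,₁X² + a₄,₃X + a₆,₅` is `a₄,₃ ≠ 0` — here we record the characteristic-free consequence
`b² − 4ac ≠ 0 ⟹ ¬(π ∣ a₄,₃ ∧ …)` only in the form needed: `π⁴ ∤ a₄` OR `2 ∉ 𝔪`).  Stated with the residue-characteristic-`2` hypothesis
`2 ∈ 𝔪`, under which `π⁴ ∤ a₄` exactly. [cite: SilvermanATAEC1994, IV.9.4 Step 7 (PDF pp. 345–346)] -/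
theorem exists_smul_of_kodairaSymbolOfMinimal_eq_Istar_two_of_two_mem [PerfectField (ResidueField R)]
    (h2 : (2 : R) ∈ maximalIdeal R) (V : WeierstrassCurve R) (hV : V.kodairaSymbolOfMinimal = .Istar 2) :
    ∃ D : WeierstrassCurve.VariableChange R, D.u = 1 ∧
      (D • V).a₁ ∈ maximalIdeal R ∧ (D • V).a₂ ∈ maximalIdeal R ∧ (D • V).a₂ ∉ maximalIdeal R ^ 2 ∧
      (D • V).a₃ ∈ maximalIdeal R ^ 3 ∧ (D • V).a₄ ∈ maximalIdeal R ^ 3 ∧ (D • V).a₄ ∉ maximalIdeal R ^ 4 ∧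
      (D • V).a₆ ∈ maximalIdeal R ^ 5 := by
  classical
  have hϖ : Irreducible (uniformizer R) := irreducible_uniformizer
  set ϖ := uniformizer R with hϖdef
  have hV' := hV
  unfold WeierstrassCurve.kodairaSymbolOfMinimal at hV'
  obtain ⟨h1, h2', h3, h4, h5, h6, h7, hidx⟩ :=
    (tateTree_eq_Istar_succ_iff _ _ _ _ _ _ _ _ _ _ _ _ _).mp hV'
  rw [not_not] at h1 h2' h3 h4 h5
  -- Steps 2 and 6
  have hex2 := exists_variableChange_step2_of_perfectField V h1
  have hN2 : normalizeStep2 V = hex2.choose • V := dif_pos hex2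
  obtain ⟨hu2, hA₃, hA₄, -⟩ := hex2.choose_spec
  rw [hN2] at h2' h3 h4 h5 h6 h7 hidx
  have hex6 := exists_variableChange_step6_of_perfectField h2' hA₃ hA₄ h3 h5 h4
  have hN6 : normalizeStep6 (hex2.choose • V) = hex6.choose • (hex2.choose • V) := dif_pos hex6
  obtain ⟨hu6, hB₁, hB₂, hB₃, hB₄, hB₆⟩ := hex6.choose_spec
  rw [hN6] at h6 h7 hidx
  set W₆ := hex6.choose • (hex2.choose • V) with hW₆
  have q1 := mem_maximalIdeal_iff_dvd.mp hB₁
  have q2 := mem_maximalIdeal_iff_dvd.mp hB₂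
  have q3 := mem_maximalIdeal_pow_iff_dvd.mp hB₃
  have q4 := mem_maximalIdeal_pow_iff_dvd.mp hB₄
  have q6 := mem_maximalIdeal_pow_iff_dvd.mp hB₆
  -- Step 7: the algorithm's own round-0 model
  have hex7 := exists_variableChange_step7_of_dvd q1 q2 q3 q4 q6 h7
  have hidx' : istarIndex W₆ = 2 := hidx
  unfold istarIndex at hidx'
  rw [dif_pos hex7] at hidx'
  simp only [] at hidx'
  obtain ⟨hu7, m1, m2, m3, m4, m6⟩ := hex7.choose_spec
  set N₇ := hex7.choose • W₆ with hN₇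
  have k1 := mem_maximalIdeal_iff_dvd.mp m1
  have k2 := mem_maximalIdeal_iff_dvd.mp m2
  have k3 := mem_maximalIdeal_pow_iff_dvd.mp m3
  have k4 := mem_maximalIdeal_pow_iff_dvd.mp m4
  have k6 := mem_maximalIdeal_pow_iff_dvd.mp m6
  have k2n : ¬ ϖ ^ 2 ∣ N₇.a₂ := by
    obtain ⟨hr, hs, ht⟩ := dvd_r_s_t_of_step6 hu7 q1 q2 q3 q4 q6 k1 k2 k3 ((pow_dvd_pow ϖ (by norm_num)).trans k4)
      ((pow_dvd_pow ϖ (by norm_num)).trans k6)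
    refine not_sq_dvd_a₂_of_distinctRootCount_eq_two k4 k6 ?_
    rw [distinctRootCount_cubicStep6_smul hu7 q1 q2 q3 q4 q6 hr hs ht]; exact h7
  have m2n : N₇.a₂ ∉ maximalIdeal R ^ 2 := fun h ↦ k2n (mem_maximalIdeal_pow_iff_dvd.mp h)
  -- enough fuel
  obtain ⟨f, hf⟩ : ∃ f, (addVal R W₆.Δ).toNat = f + 1 := by
    rcases Nat.exists_eq_succ_of_ne_zero (n := (addVal R W₆.Δ).toNat) (fun h0 ↦ by
      rw [h0, istarIndexAux_zero] at hidx'; exact absurd hidx' (by norm_num)) with ⟨f, hf⟩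
    exact ⟨f, hf⟩
  rw [hf, istarIndexAux_succ] at hidx'
  dsimp only at hidx'
  -- round 0, first test fails (else the value would be `1`)
  by_cases hA : distinctRootCount (X ^ 2 + C (redCoeff N₇.a₃ (0 + 2)) * X - C (redCoeff N₇.a₆ (2 * 0 + 4))) = 2
  · rw [if_pos hA] at hidx'; exact absurd hidx' (by norm_num)
  rw [if_neg hA] at hidx'
  have hexA : ∃ C : WeierstrassCurve.VariableChange R, C.u = 1 ∧
      (C • N₇).a₁ ∈ maximalIdeal R ∧ (C • N₇).a₂ ∈ maximalIdeal R ∧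
      (C • N₇).a₃ ∈ maximalIdeal R ^ (0 + 3) ∧ (C • N₇).a₄ ∈ maximalIdeal R ^ (0 + 3) ∧
      (C • N₇).a₆ ∈ maximalIdeal R ^ (2 * 0 + 5) :=
    exists_variableChange_istarA_of_perfectField m1 m2 (by simpa using m3) (by simpa using m4) (by simpa using m6) hA
  rw [dif_pos hexA] at hidx'
  obtain ⟨huA, hD₁, hD₂, hD₃, hD₄, hD₆⟩ := hexA.choose_spec
  set V₁ := hexA.choose • N₇ with hV₁
  have hD₂n : V₁.a₂ ∉ maximalIdeal R ^ 2 :=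
    OggBound.a₂_not_mem_sq_of_smul huA m1 m2 m2n m3 m4 m6 hD₁ hD₂
      (Ideal.pow_le_pow_right (by omega) hD₃) (Ideal.pow_le_pow_right (by omega) hD₄)
      (Ideal.pow_le_pow_right (by omega) hD₆)
  -- round 0, second test must fire (else the value is `0` or `≥ 3`)
  by_cases hB : distinctRootCount (C (redCoeff V₁.a₂ 1) * X ^ 2 + C (redCoeff V₁.a₄ (0 + 3)) * X +
      C (redCoeff V₁.a₆ (2 * 0 + 5))) = 2
  swap
  · rw [if_neg hB] at hidx'
    exfalso
    have hne2 : ∀ W' : WeierstrassCurve R, istarIndexAux f 1 W' ≠ 2 := fun W' h ↦ by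
      rcases istarIndexAux_eq_zero_or_le f 1 W' with h' | h' <;> omega
    exact hne2 _ hidx'
  -- read the exit witness: `a₄,₃ ≠ 0`, i.e. `π⁴ ∤ a₄`
  have ha2 : redCoeff V₁.a₂ 1 ≠ 0 := by
    rw [Ne, redCoeff_eq_zero_iff (by simpa using mem_maximalIdeal_iff_dvd.mp hD₂)]
    exact fun h ↦ hD₂n (mem_maximalIdeal_pow_iff_dvd.mpr h)
  have hb : redCoeff V₁.a₄ (0 + 3) ≠ 0 := by
    intro hb0
    apply discr_ne_zero_of_distinctRootCount_eq_two ha2 _ _ hB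
    have h4 : (4 : ResidueField R) = 0 := by
      rw [show (4 : ResidueField R) = 2 * 2 by norm_num, ← map_ofNat (residue R) 2, (residue_eq_zero_iff _).mpr h2, mul_zero]
    rw [hb0, h4]; ring
  have hD₄n : V₁.a₄ ∉ maximalIdeal R ^ 4 := by
    intro h
    apply hb
    exact redCoeff_eq_zero_of_dvd (mem_maximalIdeal_pow_iff_dvd.mp h)
  have hDV : (hexA.choose * hex7.choose * hex6.choose * hex2.choose) • V = V₁ := by
    simp only [mul_smul, hV₁, hN₇, hW₆]
  refine ⟨hexA.choose * hex7.choose * hex6.choose * hex2.choose, ?_, ?_⟩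
  · simp only [WeierstrassCurve.VariableChange.mul_def]
    rw [huA, hu7, hu6, hu2]; norm_num
  · rw [hDV]
    exact ⟨hD₁, hD₂, hD₂n, by simpa using hD₃, by simpa using hD₄, hD₄n, by simpa using hD₆⟩

end General


section TwoUniformizer

variable {R : Type*} [CommRing R] [IsDomain R] [IsDiscreteValuationRing R]

omit [IsDomain R] [IsDiscreteValuationRing R] in
/-- **`Δ = 2¹⁰(α⁴q² + 2Y)` on the `I₂*` form `[2α, 2p, 8γ, 8q, 32r]`** (`2` a uniformiser): so `ord Δ = 10` iff `αq` is a unit.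
[cite: SilvermanATAEC1994, IV.9.4 Step 7 and Table 4.1] -/
theorem Δ_eq_of_istarTwoForm (W : WeierstrassCurve R) {α p γ q r : R}
    (h₁ : W.a₁ = 2 * α) (h₂ : W.a₂ = 2 * p) (h₃ : W.a₃ = 2 ^ 3 * γ) (h₄ : W.a₄ = 2 ^ 3 * q) (h₆ : W.a₆ = 2 ^ 5 * r) :
    W.Δ = 2 ^ 10 * (α ^ 4 * q ^ 2 + 2 *
      (-α ^ 6 * r + α ^ 5 * γ * q - α ^ 4 * p * γ ^ 2 - 6 * α ^ 4 * p * r + 4 * α ^ 3 * p * γ * q + 2 * α ^ 3 * γ ^ 3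
       + 36 * α ^ 3 * γ * r - 4 * α ^ 2 * p ^ 2 * γ ^ 2 - 12 * α ^ 2 * p ^ 2 * r + 2 * α ^ 2 * p * q ^ 2 - 30 * α ^ 2 * γ ^ 2 * q
       + 36 * α ^ 2 * q * r + 4 * α * p ^ 2 * γ * q + 36 * α * p * γ ^ 3 + 72 * α * p * γ * r - 48 * α * γ * q ^ 2
       - 4 * p ^ 3 * γ ^ 2 - 8 * p ^ 3 * r + 2 * p ^ 2 * q ^ 2 + 36 * p * γ ^ 2 * q + 72 * p * q * r - 54 * γ ^ 4
       - 216 * γ ^ 2 * r - 16 * q ^ 3 - 216 * r ^ 2)) := by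
  simp only [WeierstrassCurve.Δ, WeierstrassCurve.b₂, WeierstrassCurve.b₄, WeierstrassCurve.b₆, WeierstrassCurve.b₈,
    h₁, h₂, h₃, h₄, h₆]
  ring

/-- **`ord Δ = 10` on the `I₂*` form forces `α ∈ Rˣ`** (`q ∈ Rˣ`; `2` a uniformiser): otherwise `2¹² ∣ Δ`.
[cite: SilvermanATAEC1994, IV.9.4 Step 7 and Table 4.1] -/
theorem isUnit_of_istarTwoForm_of_addVal_eq_ten (h2 : Irreducible (2 : R)) (W : WeierstrassCurve R) {α p γ q r : R}
    (h₁ : W.a₁ = 2 * α) (h₂ : W.a₂ = 2 * p) (h₃ : W.a₃ = 2 ^ 3 * γ) (h₄ : W.a₄ = 2 ^ 3 * q) (h₆ : W.a₆ = 2 ^ 5 * r)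
    (hΔ0 : W.Δ ≠ 0) (hΔ : (addVal R W.Δ).toNat = 10) : IsUnit α := by
  by_contra hα
  obtain ⟨α₁, hα₁⟩ := (not_isUnit_iff_dvd h2 _).mp hα
  have h12 : (2 : R) ^ 12 ∣ W.Δ := by
    rw [Δ_eq_of_istarTwoForm W h₁ h₂ h₃ h₄ h₆, hα₁]
    refine ⟨4 * α₁ ^ 4 * q ^ 2 + (-32 * α₁ ^ 6 * r + 16 * α₁ ^ 5 * γ * q - 8 * α₁ ^ 4 * p * γ ^ 2 - 48 * α₁ ^ 4 * p * r
       + 16 * α₁ ^ 3 * p * γ * q + 8 * α₁ ^ 3 * γ ^ 3 + 144 * α₁ ^ 3 * γ * r - 8 * α₁ ^ 2 * p ^ 2 * γ ^ 2 - 24 * α₁ ^ 2 * p ^ 2 * r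
       + 4 * α₁ ^ 2 * p * q ^ 2 - 60 * α₁ ^ 2 * γ ^ 2 * q + 72 * α₁ ^ 2 * q * r + 4 * α₁ * p ^ 2 * γ * q + 36 * α₁ * p * γ ^ 3
       + 72 * α₁ * p * γ * r - 48 * α₁ * γ * q ^ 2 - 2 * p ^ 3 * γ ^ 2 - 4 * p ^ 3 * r + p ^ 2 * q ^ 2 + 18 * p * γ ^ 2 * q
       + 36 * p * q * r - 27 * γ ^ 4 - 108 * γ ^ 2 * r - 8 * q ^ 3 - 108 * r ^ 2), by ring⟩
  have := le_addVal_toNat_of_pow_dvd h2 hΔ0 h12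
  omega

end TwoUniformizer

end Summit.BirchSwinnertonDyer.BirchSwinnertonDyer.Theorems.ManinLocalTwoThree

end
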